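import Summits.CriticalPhenomena.PercolationContinuityZ3.Theorems.Transplant.FKConnectivityAllQAntipodalOrAttSides
import HarnessLib

/-!
# Connectivity correlation inequalities for `φ_{w,q}`, every `q > 0` — file 47b: the OR-ATTACHED drift `O(N; y, z; C)` across a SERIES junction
# (towards the `q`-free level-3 inequality for the type `x ∧ (y ∨ z)`, Conjecture `C_∞⁺` of gen 21)

Support file (`--supports stmt-CriticalPhenomena-4575`), FK sub-lane `prim-bschramm-fk-2` (gen 22); builds on p205010 (kernel theorem,
internal audit signed; external expert review pending).  No definitions, no named facts, no sorries; standard axioms.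

`O(N; y, z; C) = D(yzC | C) + D(zC | yC) + D(yC | zC)` (root `st`; module docstring of `…OrAttSides`).  Across a series junction
`E = E₁(s,m) · E₂(m,t)` the general weighted series identity `FK.andGenW_series_eq` (arbitrary attached sets) is applied to each of the three
drifts and the side terms are REGROUPED ACROSS THE DRIFTS:
* `FK.orAttW_series_split_nonpos` (`y ∈ E₁`, `z ∈ E₂`): the drifts `(yzC|C)` and `(zC|yC)` carry the same side-2 data, so on side 1 they pair
  (`FK.twoSidedW_pair_insert_eq`) into the U-drift of the free set `N₁ ∪ {y}` (root `sm`, contracted `C₁`), their rootless companions cancel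
  (`FK.twoSidedW_swap`); the drift `(yC|zC)` contributes on side 1 the AND-contracted drift `(yC₁|C₁)` with and without root; symmetrically on
  side 2.  All six side functionals are instances of the master weighted AND theorem — NO induction hypothesis is needed at a separating junction.
* `FK.orAttW_series_same₁_nonpos` / `…same₂…` (`y, z` on one side): that side carries `O` with the virtual root (the induction hypothesis) and,
  rootless, the AND-contracted drift `(yzCᵢ|Cᵢ)` (the two mixed rootless drifts cancel); the other side carries U-drifts with `0/1` coefficients.
[cite: Grimmett2006, §1.4 eq. (1.20) (p. 15); §3.8 Thm. (3.90) (pp. 61–62); §3.9 (pp. 63–64)] [cite: Wagner2006, Thm. 5.8(d), §5.3]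
-/

noncomputable section

namespace Summit.CriticalPhenomena.PercolationContinuityZ3.Theorems

namespace FK

open SimpleGraph Literature.Probability.LatticeModels Literature.Probability.Percolation
open scoped Classical

variable {V : Type*} [Fintype V]

section OrAttSeries

variable {E₁ E₂ : Finset (Sym2 V)} {V₁ V₂ : Set V} {s m t : V}

/-- Bookkeeping: six real numbers grouped as in a three-fold application of the series identity. [folklore] -/
private theorem six_le {R₁ F₁ R₂ F₂ R₃ F₃ : ℝ} (h₁ : R₁ + R₂ ≤ 0) (h₂ : R₃ ≤ 0) (h₃ : F₁ + F₃ ≤ 0) (h₄ : F₂ ≤ 0) :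
    R₁ + F₁ + (R₂ + F₂) + (R₃ + F₃) ≤ 0 := by linarith

/-- Bookkeeping: the `0/1`-weighted pair at a fixed outer configuration. [folklore] -/
private theorem ite_pair_le (c : Prop) [Decidable c] {A B A' B' : ℝ} (h₁ : A + A' ≤ 0) (h₂ : B + B' = 0) :
    (if c then (1 : ℝ) else 0) * A + (if c then (0 : ℝ) else 1) * B +
      ((if c then (1 : ℝ) else 0) * A' + (if c then (0 : ℝ) else 1) * B') ≤ 0 := by
  split_ifs <;> linarith

/-- **`O` ACROSS A SERIES JUNCTION THAT SEPARATES `y` FROM `z`** (`y ∈ E₁`, `z ∈ E₂`; abstract form, ANTITONE weights).  Inputs: on side 1 the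
weighted U-drift of the free set `N₁ ∪ {y}` (root `sm`, contracted `C₁`), the AND-contracted drift `(yC₁ | C₁)` with root `sm` and without root;
on side 2 the same with `z`, `mt`; each `≤ 0` for every antitone weight and monotone test function.  Output: the three drifts of
`O(N₁ ∪ N₂; y, z; C₁ ∪ C₂)` with root `st` add up to `≤ 0`. [cite: Grimmett2006, §3.8 Thm. (3.90) (pp. 61–62)] -/
theorem orAttW_series_split_nonpos (h₁ : ∀ e ∈ (↑E₁ : Set (Sym2 V)), ∀ z ∈ e, z ∈ V₁)
    (h₂ : ∀ e ∈ (↑E₂ : Set (Sym2 V)), ∀ z ∈ e, z ∈ V₂) (hS : V₁ ∩ V₂ ⊆ {m}) (hsV₂ : s ∉ V₂) (htV₁ : t ∉ V₁)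
    (hsm : s ≠ m) (htm : t ≠ m) (hst : s ≠ t)
    {N₁ C₁ N₂ C₂ : Finset (Sym2 V)} {y z : Sym2 V} (hd : Disjoint N₁ N₂) (hN₁ : N₁ ⊆ E₁) (hC₁ : C₁ ⊆ E₁) (hy : y ∈ E₁) (hyN : y ∉ N₁)
    (hN₂ : N₂ ⊆ E₂) (hC₂ : C₂ ⊆ E₂) (hz : z ∈ E₂) (hzN : z ∉ N₂)
    (hU₁ : ∀ w' : ℕ → ℝ, (∀ n : ℕ, w' (n + 1) ≤ w' n) → ∀ h' : Finset (Sym2 V) → ℝ,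
      (∀ ⦃A B : Finset (Sym2 V)⦄, A ⊆ B → B ⊆ insert y N₁ → h' A ≤ h' B) →
      ∑ γ ∈ (insert y N₁).powerset, (w' (clusterCount (↑(insert s(s, m) (γ ∪ C₁)) : BondConfig V) ∅ +
          clusterCount (↑(insert y N₁ \ γ ∪ C₁) : BondConfig V) ∅) -
        w' (clusterCount (↑(insert s(s, m) (insert y N₁ \ γ ∪ C₁)) : BondConfig V) ∅ + clusterCount (↑(γ ∪ C₁) : BondConfig V) ∅)) *
          h' γ ≤ 0)
    (hA₁ : ∀ w' : ℕ → ℝ, (∀ n : ℕ, w' (n + 1) ≤ w' n) → ∀ h' : Finset (Sym2 V) → ℝ,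
      (∀ ⦃A B : Finset (Sym2 V)⦄, A ⊆ B → B ⊆ N₁ → h' A ≤ h' B) →
      ∑ γ ∈ N₁.powerset, (w' (clusterCount (↑(insert s(s, m) (γ ∪ insert y C₁)) : BondConfig V) ∅ +
          clusterCount (↑(N₁ \ γ ∪ C₁) : BondConfig V) ∅) -
        w' (clusterCount (↑(insert s(s, m) (N₁ \ γ ∪ insert y C₁)) : BondConfig V) ∅ + clusterCount (↑(γ ∪ C₁) : BondConfig V) ∅)) *
          h' γ ≤ 0)
    (hR₁ : ∀ w' : ℕ → ℝ, (∀ n : ℕ, w' (n + 1) ≤ w' n) → ∀ h' : Finset (Sym2 V) → ℝ,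
      (∀ ⦃A B : Finset (Sym2 V)⦄, A ⊆ B → B ⊆ N₁ → h' A ≤ h' B) →
      ∑ γ ∈ N₁.powerset, (w' (clusterCount (↑(γ ∪ insert y C₁) : BondConfig V) ∅ + clusterCount (↑(N₁ \ γ ∪ C₁) : BondConfig V) ∅) -
        w' (clusterCount (↑(N₁ \ γ ∪ insert y C₁) : BondConfig V) ∅ + clusterCount (↑(γ ∪ C₁) : BondConfig V) ∅)) * h' γ ≤ 0)
    (hU₂ : ∀ w' : ℕ → ℝ, (∀ n : ℕ, w' (n + 1) ≤ w' n) → ∀ h' : Finset (Sym2 V) → ℝ,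
      (∀ ⦃A B : Finset (Sym2 V)⦄, A ⊆ B → B ⊆ insert z N₂ → h' A ≤ h' B) →
      ∑ γ ∈ (insert z N₂).powerset, (w' (clusterCount (↑(insert s(m, t) (γ ∪ C₂)) : BondConfig V) ∅ +
          clusterCount (↑(insert z N₂ \ γ ∪ C₂) : BondConfig V) ∅) -
        w' (clusterCount (↑(insert s(m, t) (insert z N₂ \ γ ∪ C₂)) : BondConfig V) ∅ + clusterCount (↑(γ ∪ C₂) : BondConfig V) ∅)) *
          h' γ ≤ 0)
    (hA₂ : ∀ w' : ℕ → ℝ, (∀ n : ℕ, w' (n + 1) ≤ w' n) → ∀ h' : Finset (Sym2 V) → ℝ,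
      (∀ ⦃A B : Finset (Sym2 V)⦄, A ⊆ B → B ⊆ N₂ → h' A ≤ h' B) →
      ∑ γ ∈ N₂.powerset, (w' (clusterCount (↑(insert s(m, t) (γ ∪ insert z C₂)) : BondConfig V) ∅ +
          clusterCount (↑(N₂ \ γ ∪ C₂) : BondConfig V) ∅) -
        w' (clusterCount (↑(insert s(m, t) (N₂ \ γ ∪ insert z C₂)) : BondConfig V) ∅ + clusterCount (↑(γ ∪ C₂) : BondConfig V) ∅)) *
          h' γ ≤ 0)
    (hR₂ : ∀ w' : ℕ → ℝ, (∀ n : ℕ, w' (n + 1) ≤ w' n) → ∀ h' : Finset (Sym2 V) → ℝ,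
      (∀ ⦃A B : Finset (Sym2 V)⦄, A ⊆ B → B ⊆ N₂ → h' A ≤ h' B) →
      ∑ γ ∈ N₂.powerset, (w' (clusterCount (↑(γ ∪ insert z C₂) : BondConfig V) ∅ + clusterCount (↑(N₂ \ γ ∪ C₂) : BondConfig V) ∅) -
        w' (clusterCount (↑(N₂ \ γ ∪ insert z C₂) : BondConfig V) ∅ + clusterCount (↑(γ ∪ C₂) : BondConfig V) ∅)) * h' γ ≤ 0)
    {w : ℕ → ℝ} (hw : ∀ n : ℕ, w (n + 1) ≤ w n)
    {g : Finset (Sym2 V) → ℝ} (hmono : ∀ ⦃A B : Finset (Sym2 V)⦄, A ⊆ B → B ⊆ N₁ ∪ N₂ → g A ≤ g B) :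
    ∑ γ ∈ (N₁ ∪ N₂).powerset,
        (w (clusterCount (↑(insert s(s, t) (γ ∪ (insert y C₁ ∪ insert z C₂))) : BondConfig V) ∅ +
              clusterCount (↑((N₁ ∪ N₂) \ γ ∪ (C₁ ∪ C₂)) : BondConfig V) ∅) -
          w (clusterCount (↑(insert s(s, t) ((N₁ ∪ N₂) \ γ ∪ (insert y C₁ ∪ insert z C₂))) : BondConfig V) ∅ +
              clusterCount (↑(γ ∪ (C₁ ∪ C₂)) : BondConfig V) ∅)) * g γ +
      ∑ γ ∈ (N₁ ∪ N₂).powerset,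
        (w (clusterCount (↑(insert s(s, t) (γ ∪ (C₁ ∪ insert z C₂))) : BondConfig V) ∅ +
              clusterCount (↑((N₁ ∪ N₂) \ γ ∪ (insert y C₁ ∪ C₂)) : BondConfig V) ∅) -
          w (clusterCount (↑(insert s(s, t) ((N₁ ∪ N₂) \ γ ∪ (C₁ ∪ insert z C₂))) : BondConfig V) ∅ +
              clusterCount (↑(γ ∪ (insert y C₁ ∪ C₂)) : BondConfig V) ∅)) * g γ +
      ∑ γ ∈ (N₁ ∪ N₂).powerset,
        (w (clusterCount (↑(insert s(s, t) (γ ∪ (insert y C₁ ∪ C₂))) : BondConfig V) ∅ +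
              clusterCount (↑((N₁ ∪ N₂) \ γ ∪ (C₁ ∪ insert z C₂)) : BondConfig V) ∅) -
          w (clusterCount (↑(insert s(s, t) ((N₁ ∪ N₂) \ γ ∪ (insert y C₁ ∪ C₂))) : BondConfig V) ∅ +
              clusterCount (↑(γ ∪ (C₁ ∪ insert z C₂)) : BondConfig V) ∅)) * g γ ≤ 0 := by
  have hyC₁ : insert y C₁ ⊆ E₁ := Finset.insert_subset hy hC₁
  have hzC₂ : insert z C₂ ⊆ E₂ := Finset.insert_subset hz hC₂
  -- the three series identities, for the shifted weight `n ↦ w(n − T)`, `T = 2|V| + 1`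
  have key₁ := andGenW_series_eq (fun k => w (k - (2 * Fintype.card V + 1))) h₁ h₂ hS hsV₂ htV₁ hsm htm hst hd hN₁ hyC₁ hC₁
    hN₂ hzC₂ hC₂ g
  have key₂ := andGenW_series_eq (fun k => w (k - (2 * Fintype.card V + 1))) h₁ h₂ hS hsV₂ htV₁ hsm htm hst hd hN₁ hC₁ hyC₁
    hN₂ hzC₂ hC₂ g
  have key₃ := andGenW_series_eq (fun k => w (k - (2 * Fintype.card V + 1))) h₁ h₂ hS hsV₂ htV₁ hsm htm hst hd hN₁ hyC₁ hC₁
    hN₂ hC₂ hzC₂ g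
  simp only [Nat.add_sub_cancel] at key₁ key₂ key₃
  rw [key₁, key₂, key₃]
  have sec₁ : ∀ γ₂ ∈ N₂.powerset, ∀ ⦃A B : Finset (Sym2 V)⦄, A ⊆ B → B ⊆ N₁ → g (A ∪ γ₂) ≤ g (B ∪ γ₂) := by
    intro γ₂ hγ₂ A B hAB hB
    rw [Finset.mem_powerset] at hγ₂
    exact hmono (Finset.union_subset_union hAB le_rfl) (Finset.union_subset_union hB hγ₂)
  have sec₂ : ∀ γ₁ ∈ N₁.powerset, ∀ ⦃A B : Finset (Sym2 V)⦄, A ⊆ B → B ⊆ N₂ → g (γ₁ ∪ A) ≤ g (γ₁ ∪ B) := by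
    intro γ₁ hγ₁ A B hAB hB
    rw [Finset.mem_powerset] at hγ₁
    exact hmono (Finset.union_subset_union le_rfl hAB) (Finset.union_subset_union hγ₁ hB)
  have sec₁' : ∀ γ₂ ∈ N₂.powerset, ∀ ⦃A B : Finset (Sym2 V)⦄, A ⊆ B → B ⊆ insert y N₁ → g (A.erase y ∪ γ₂) ≤ g (B.erase y ∪ γ₂) := by
    intro γ₂ hγ₂ A B hAB hB
    refine sec₁ γ₂ hγ₂ (Finset.erase_subset_erase _ hAB) ?_
    intro e he
    have he' := hB (Finset.mem_of_mem_erase he)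
    rcases Finset.mem_insert.1 he' with h' | h'
    · exact absurd h' (Finset.ne_of_mem_erase he)
    · exact h'
  have sec₂' : ∀ γ₁ ∈ N₁.powerset, ∀ ⦃A B : Finset (Sym2 V)⦄, A ⊆ B → B ⊆ insert z N₂ → g (γ₁ ∪ A.erase z) ≤ g (γ₁ ∪ B.erase z) := by
    intro γ₁ hγ₁ A B hAB hB
    refine sec₂ γ₁ hγ₁ (Finset.erase_subset_erase _ hAB) ?_
    intro e he
    have he' := hB (Finset.mem_of_mem_erase he)
    rcases Finset.mem_insert.1 he' with h' | h'
    · exact absurd h' (Finset.ne_of_mem_erase he)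
    · exact h'
  have shift : ∀ c : ℕ, ∀ n : ℕ, w (n + 1 + c - (2 * Fintype.card V + 1)) ≤ w (n + c - (2 * Fintype.card V + 1)) := fun c n => by
    have := antitoneW_sub hw (2 * Fintype.card V + 1) (n + c)
    rw [Nat.add_right_comm n 1 c]
    exact this
  refine six_le ?_ ?_ ?_ ?_
  · -- side 1: the pair {(yzC|C), (zC|yC)} — U-drift of `N₁ ∪ {y}`, rootless companions cancel
    rw [← Finset.sum_add_distrib]
    refine Finset.sum_nonpos fun γ₂ hγ₂ => ?_
    set c₂ := clusterCount (↑(N₂ \ γ₂ ∪ insert z C₂) : BondConfig V) ∅ + clusterCount (↑(γ₂ ∪ C₂) : BondConfig V) ∅ with hc₂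
    refine ite_pair_le _ ?_ ?_
    · have e := twoSidedW_pair_insert_eq (fun n => w (n + (c₂ + 1) - (2 * Fintype.card V + 1))) C₁ C₁ s(s, m) hyN
        (fun γ₁ => g (γ₁ ∪ γ₂))
      have u := hU₁ (fun n => w (n + (c₂ + 1) - (2 * Fintype.card V + 1))) (shift (c₂ + 1)) (fun γ => g (γ.erase y ∪ γ₂))
        (sec₁' γ₂ hγ₂)
      rw [e]
      exact u
    · have e := twoSidedW_swap (fun n => w (n + c₂ - (2 * Fintype.card V + 1))) N₁ (insert y C₁) C₁ (fun γ₁ => g (γ₁ ∪ γ₂))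
      exact e
  · -- side 1: the drift (yC|zC) — AND-contracted drift with and without root
    refine Finset.sum_nonpos fun γ₂ hγ₂ => ?_
    set c₂ := clusterCount (↑(N₂ \ γ₂ ∪ C₂) : BondConfig V) ∅ + clusterCount (↑(γ₂ ∪ insert z C₂) : BondConfig V) ∅ with hc₂
    have i₁ := hA₁ (fun n => w (n + (c₂ + 1) - (2 * Fintype.card V + 1))) (shift (c₂ + 1)) (fun γ₁ => g (γ₁ ∪ γ₂)) (sec₁ γ₂ hγ₂)
    have i₂ := hR₁ (fun n => w (n + c₂ - (2 * Fintype.card V + 1))) (shift c₂) (fun γ₁ => g (γ₁ ∪ γ₂)) (sec₁ γ₂ hγ₂)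
    refine add_nonpos (mul_nonpos_of_nonneg_of_nonpos ?_ i₁) (mul_nonpos_of_nonneg_of_nonpos ?_ i₂) <;>
    split_ifs <;> norm_num
  · -- side 2: the pair {(yzC|C), (yC|zC)} — U-drift of `N₂ ∪ {z}`
    rw [← Finset.sum_add_distrib]
    refine Finset.sum_nonpos fun γ₁ hγ₁ => ?_
    set c₁ := clusterCount (↑(γ₁ ∪ insert y C₁) : BondConfig V) ∅ + clusterCount (↑(N₁ \ γ₁ ∪ C₁) : BondConfig V) ∅ with hc₁
    refine ite_pair_le _ ?_ ?_
    · have e := twoSidedW_pair_insert_eq (fun n => w (n + (c₁ + 1) - (2 * Fintype.card V + 1))) C₂ C₂ s(m, t) hzN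
        (fun γ₂ => g (γ₁ ∪ γ₂))
      have u := hU₂ (fun n => w (n + (c₁ + 1) - (2 * Fintype.card V + 1))) (shift (c₁ + 1)) (fun γ => g (γ₁ ∪ γ.erase z))
        (sec₂' γ₁ hγ₁)
      rw [e]
      exact u
    · have e := twoSidedW_swap (fun n => w (n + c₁ - (2 * Fintype.card V + 1))) N₂ (insert z C₂) C₂ (fun γ₂ => g (γ₁ ∪ γ₂))
      exact e
  · -- side 2: the drift (zC|yC) — AND-contracted drift with and without root
    refine Finset.sum_nonpos fun γ₁ hγ₁ => ?_
    set c₁ := clusterCount (↑(γ₁ ∪ C₁) : BondConfig V) ∅ + clusterCount (↑(N₁ \ γ₁ ∪ insert y C₁) : BondConfig V) ∅ with hc₁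
    have i₁ := hA₂ (fun n => w (n + (c₁ + 1) - (2 * Fintype.card V + 1))) (shift (c₁ + 1)) (fun γ₂ => g (γ₁ ∪ γ₂)) (sec₂ γ₁ hγ₁)
    have i₂ := hR₂ (fun n => w (n + c₁ - (2 * Fintype.card V + 1))) (shift c₁) (fun γ₂ => g (γ₁ ∪ γ₂)) (sec₂ γ₁ hγ₁)
    refine add_nonpos (mul_nonpos_of_nonneg_of_nonpos ?_ i₁) (mul_nonpos_of_nonneg_of_nonpos ?_ i₂) <;>
    split_ifs <;> norm_num


end OrAttSeries

end FK

end Summit.CriticalPhenomena.PercolationContinuityZ3.Theorems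

end
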